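import Literature.AlgebraicGeometry.Resolution.HenselizationDegree
import HarnessLib

/-!
# A Galois extension below the henselization carries one valuation over the decomposition field

Topic: `Literature/AlgebraicGeometry/Resolution` (valued fields; henselization). Groundwork for
the algebraization step of M. Temkin, *Inseparable local uniformization*, J. Algebra 373 (2013) =
arXiv:0804.1554v3, Thm. 3.3.1 (tree: `Temkin2013RelativeCurveSmoothFibre`), where the finite
separable constant field extension `m` is taken inside the henselization `L = L₁^h` of the
valued function field and enlarged to `m = M ∩ L`, `M` its Galois closure: then EVERY valuation
of `M` over `m° = m ∩ L°` is the restriction of the valuation of `L·M` — in other words the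
conjugate discs of a point seen from `m` are all "near", the mechanism that lets the `m`-rational
disc of Temkin's Step 3 be cut out of the `K`-rational model (cf. the proof of Thm. 3.3.1, Step 3,
p. 45, and of Thm. 2.4.3 (iii): "the connected component … which contains the preimage of `yᵢ`").

Classical content (F.-V. Kuhlmann, Trans. AMS 362 (2010), §1.1: the henselization is the
decomposition field of the separable closure, and the extensions of a valuation to a normal
extension are conjugate; O. Endler, *Valuation theory*, §17: over the decomposition field the
valuation extends uniquely): if `M|m` is finite Galois, `m ≤ L` with `(L, V ∩ L)` henselian and
`M ∩ L ⊆ m` (so that `m` contains the decomposition field `M ∩ m^h`), then `V ∩ M` is the unique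
extension of `V ∩ m` to `M`.

* `apply_mem_iff_mem_of_isGalois` — every `m`-automorphism of `m̃` preserves `V` on `M` — PROVED
  (the stabilizer of `V ∩ m̃` in `Aut(m̃|m)` is `Aut(m̃|m^h)`, `smul_comap_algebraicClosure_eq_iff`;
  its image in `Gal(M|m)` has fixed field `M ∩ m^h ⊆ M ∩ L ⊆ m`, hence is everything);
* `mem_iff_mem_of_isGalois_of_forall_mem` — **uniqueness**: every valuation ring `W` of the
  ambient algebraically closed `Ω` with `W ∩ m = V ∩ m` satisfies `W ∩ M = V ∩ M` — PROVED
  (conjugacy of the extensions to `m̃`, `exists_smul_eq_of_normal`, and the previous theorem);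
* `algEquiv_apply_mem_iff_mem_of_isGalois` — `Gal(M|m)` preserves `V` on `M` — PROVED.

All statements are [folklore]; no definitions, no named facts.

## Sources

* F.-V. Kuhlmann, Trans. AMS 362 (2010) = arXiv:1003.5678, §1.1 (henselization = decomposition
  field; conjugacy), through the tree (`Henselization.lean`, `HenselizationDegree.lean`,
  `ValuationConjugacyNormal.lean`).
* O. Endler, *Valuation theory*, Springer 1972, §17 (classical background; not held).
* M. Temkin, arXiv:0804.1554v3, proof of Thm. 3.3.1, Step 3 (the use).
-/

noncomputable section

open scoped Pointwise

namespace Literature.AlgebraicGeometry.Resolution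

universe u

variable {Ω : Type u} [Field Ω] [IsAlgClosed Ω] (V : ValuationSubring Ω) (m : Subfield Ω)

/-- **Every `m`-automorphism of `m̃` preserves `V` on `M`** (the heart of the matter): in the
situation of the module docstring — `M|m` finite Galois inside `m̃ ⊆ Ω`, `m ≤ L` henselian for
`V ∩ L`, `M ∩ L ⊆ m` — for every `τ ∈ Aut(m̃|m)` and `z ∈ M`: `τ z ∈ V ↔ z ∈ V`. (The
stabilizer of `V ∩ m̃` is `Aut(m̃|m^h)`; its image in `Gal(M|m)` has fixed field
`M ∩ m^h ⊆ M ∩ L ⊆ m`, hence is all of `Gal(M|m)`.) [folklore] -/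
theorem apply_mem_iff_mem_of_isGalois (M : IntermediateField m (algebraicClosure m Ω))
    [FiniteDimensional m M] [IsGalois m M] (L : Subfield Ω) (hmL : m ≤ L)
    (hL : IsHenselianField L (V.comap (algebraMap L Ω)))
    (hML : ∀ z : M, ((z : algebraicClosure m Ω) : Ω) ∈ L → ((z : algebraicClosure m Ω) : Ω) ∈ m)
    (τ : (algebraicClosure m Ω) ≃ₐ[m] (algebraicClosure m Ω)) (z : M) :
    ((τ (z : algebraicClosure m Ω) : algebraicClosure m Ω) : Ω) ∈ V ↔
      ((z : algebraicClosure m Ω) : Ω) ∈ V := by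
  classical
  haveI : IsAlgClosed (algebraicClosure m Ω) := IsAlgClosure.isAlgClosed m
  set VA : ValuationSubring (algebraicClosure m Ω) :=
    V.comap (algebraMap (algebraicClosure m Ω) Ω) with hVA
  -- `m^sep ≤ m̃` as algebras
  have hNA : separableClosure m Ω ≤ algebraicClosure m Ω := separableClosure_le_algebraicClosure m
  letI : Algebra (separableClosure m Ω) (algebraicClosure m Ω) :=
    (IntermediateField.inclusion hNA).toRingHom.toAlgebra
  haveI : IsScalarTower m (separableClosure m Ω) (algebraicClosure m Ω) :=
    IsScalarTower.of_algebraMap_eq fun _ => rfl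
  have hinclinj : Function.Injective
      (algebraMap (separableClosure m Ω) (algebraicClosure m Ω)) :=
    (IntermediateField.inclusion hNA).toRingHom.injective
  -- the stabilizer of `V ∩ m̃` is `Aut(m̃ | m^h)`
  set S : Subgroup ((algebraicClosure m Ω) ≃ₐ[m] (algebraicClosure m Ω)) :=
    MulAction.stabilizer ((algebraicClosure m Ω) ≃ₐ[m] (algebraicClosure m Ω)) VA with hSdef
  have hS : ∀ σ : (algebraicClosure m Ω) ≃ₐ[m] (algebraicClosure m Ω), σ ∈ S ↔
      ∀ x : algebraicClosure m Ω, (x : Ω) ∈ henselization V m → σ x = x := fun σ => by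
    rw [hSdef, MulAction.mem_stabilizer_iff]
    exact smul_comap_algebraicClosure_eq_iff V m σ
  -- restriction to `M` and the subgroup `H = S|_M`
  set r : ((algebraicClosure m Ω) ≃ₐ[m] (algebraicClosure m Ω)) →* (M ≃ₐ[m] M) :=
    AlgEquiv.restrictNormalHom M with hrdef
  have hr : ∀ (σ : (algebraicClosure m Ω) ≃ₐ[m] (algebraicClosure m Ω)) (x : M),
      ((r σ x : M) : algebraicClosure m Ω) = σ (x : algebraicClosure m Ω) := fun σ x =>
    AlgEquiv.restrictNormalHom_apply M σ x
  set H : Subgroup (M ≃ₐ[m] M) := S.map r with hHdef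
  -- the fixed field of `H` is `m`: it lies in `M ∩ m^h ⊆ M ∩ L ⊆ m`
  have hH : IntermediateField.fixedField H = ⊥ := by
    refine le_antisymm (fun x hx => ?_) bot_le
    rw [IntermediateField.mem_fixedField_iff] at hx
    -- `x` is separable over `m`
    have hxs : ((x : algebraicClosure m Ω) : Ω) ∈ separableClosure m Ω := by
      rw [mem_separableClosure_iff]
      have h1 : IsSeparable m x := Algebra.IsSeparable.isSeparable m x
      have h2 : IsSeparable m (x : algebraicClosure m Ω) :=
        (isSeparable_map_iff (IsScalarTower.toAlgHom m M (algebraicClosure m Ω))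
          (RingHom.injective _)).mpr h1
      exact (isSeparable_map_iff (algebraicClosure m Ω).val Subtype.val_injective).mpr h2
    -- `x ∈ m^h`: every element of the decomposition group fixes it
    have hxh : ((x : algebraicClosure m Ω) : Ω) ∈ henselization V m := by
      rw [mem_henselization_iff]
      refine ⟨hxs, fun σ' hσ' => ?_⟩
      let σ : (algebraicClosure m Ω) ≃ₐ[m] (algebraicClosure m Ω) :=
        σ'.liftNormal (algebraicClosure m Ω)
      have hσS : σ ∈ S := by
        rw [hS]
        intro y hy
        obtain ⟨hys, hfix⟩ := (mem_henselization_iff V m).mp hy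
        have h1 : y = algebraMap (separableClosure m Ω) (algebraicClosure m Ω) ⟨y, hys⟩ :=
          Subtype.ext rfl
        rw [h1, AlgEquiv.liftNormal_commutes, hfix σ' hσ']
      have h3 : r σ x = x := hx (r σ) (Subgroup.mem_map_of_mem r hσS)
      have h4 : σ (x : algebraicClosure m Ω) = (x : algebraicClosure m Ω) := by
        rw [← hr, h3]
      have h5 : (x : algebraicClosure m Ω) =
          algebraMap (separableClosure m Ω) (algebraicClosure m Ω)
            ⟨(x : algebraicClosure m Ω), hxs⟩ := Subtype.ext rfl
      rw [h5, AlgEquiv.liftNormal_commutes] at h4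
      exact hinclinj h4
    have hxL : ((x : algebraicClosure m Ω) : Ω) ∈ L :=
      henselization_le_of_isHenselianField V m hmL hL hxh
    have hxm : ((x : algebraicClosure m Ω) : Ω) ∈ m := hML x hxL
    rw [IntermediateField.mem_bot]
    exact ⟨⟨_, hxm⟩, Subtype.ext (Subtype.ext rfl)⟩
  have hHtop : H = ⊤ := by
    rw [← IntermediateField.fixingSubgroup_fixedField H, hH, IntermediateField.fixingSubgroup_bot]
  -- every `m`-automorphism of `m̃` agrees on `M` with an element of the stabilizer
  have h1 : r τ ∈ H := by rw [hHtop]; exact Subgroup.mem_top _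
  obtain ⟨δ, hδS, hδ⟩ := Subgroup.mem_map.mp h1
  have h2 : δ (z : algebraicClosure m Ω) = τ (z : algebraicClosure m Ω) := by
    rw [← hr, ← hr, hδ]
  change τ (z : algebraicClosure m Ω) ∈ VA ↔ (z : algebraicClosure m Ω) ∈ VA
  rw [← h2]
  have hδ' : δ • VA = VA := MulAction.mem_stabilizer_iff.mp hδS
  have e := apply_mem_smul_valuationSubring_iff δ VA (z : algebraicClosure m Ω)
  rw [hδ'] at e
  exact e

/-- **Below the henselization, a Galois extension sees one valuation.** Let `(Ω, V)` be an
algebraically closed valued field, `m ≤ Ω` a subfield, `M` a finite Galois extension of `m`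
inside the algebraic closure `m̃` of `m` in `Ω`, and `L ≤ Ω` a subfield containing `m` such that
`(L, V ∩ L)` is henselian and `M ∩ L ⊆ m`. Then every valuation ring `W` of `Ω` inducing `V ∩ m`
on `m` induces `V ∩ M` on `M`. [folklore] -/
theorem mem_iff_mem_of_isGalois_of_forall_mem (M : IntermediateField m (algebraicClosure m Ω))
    [FiniteDimensional m M] [IsGalois m M] (L : Subfield Ω) (hmL : m ≤ L)
    (hL : IsHenselianField L (V.comap (algebraMap L Ω)))
    (hML : ∀ z : M, ((z : algebraicClosure m Ω) : Ω) ∈ L → ((z : algebraicClosure m Ω) : Ω) ∈ m)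
    (W : ValuationSubring Ω) (hW : ∀ z ∈ m, z ∈ W ↔ z ∈ V) (z : M) :
    ((z : algebraicClosure m Ω) : Ω) ∈ W ↔ ((z : algebraicClosure m Ω) : Ω) ∈ V := by
  classical
  haveI : IsAlgClosed (algebraicClosure m Ω) := IsAlgClosure.isAlgClosed m
  set VA : ValuationSubring (algebraicClosure m Ω) :=
    V.comap (algebraMap (algebraicClosure m Ω) Ω) with hVA
  set WA : ValuationSubring (algebraicClosure m Ω) :=
    W.comap (algebraMap (algebraicClosure m Ω) Ω) with hWA
  -- conjugacy of `V ∩ m̃` and `W ∩ m̃` over `m`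
  have hcomap : VA.comap (algebraMap m (algebraicClosure m Ω)) =
      WA.comap (algebraMap m (algebraicClosure m Ω)) := by
    ext c
    change (c : Ω) ∈ V ↔ (c : Ω) ∈ W
    exact (hW c c.2).symm
  obtain ⟨ρ, hρ⟩ := exists_smul_eq_of_normal m VA WA hcomap
  change (z : algebraicClosure m Ω) ∈ WA ↔ (z : algebraicClosure m Ω) ∈ VA
  rw [← hρ, mem_smul_valuationSubring_iff]
  exact apply_mem_iff_mem_of_isGalois V m M L hmL hL hML ρ.symm z

/-- **`Gal(M|m)` preserves `V` on `M`** (same hypotheses): for `θ ∈ Gal(M|m)` and `z ∈ M`,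
`θ z ∈ V ↔ z ∈ V`. [folklore] -/
theorem algEquiv_apply_mem_iff_mem_of_isGalois (M : IntermediateField m (algebraicClosure m Ω))
    [FiniteDimensional m M] [IsGalois m M] (L : Subfield Ω) (hmL : m ≤ L)
    (hL : IsHenselianField L (V.comap (algebraMap L Ω)))
    (hML : ∀ z : M, ((z : algebraicClosure m Ω) : Ω) ∈ L → ((z : algebraicClosure m Ω) : Ω) ∈ m)
    (θ : M ≃ₐ[m] M) (z : M) :
    (((θ z : M) : algebraicClosure m Ω) : Ω) ∈ V ↔ ((z : algebraicClosure m Ω) : Ω) ∈ V := by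
  haveI : IsAlgClosed (algebraicClosure m Ω) := IsAlgClosure.isAlgClosed m
  let τ : (algebraicClosure m Ω) ≃ₐ[m] (algebraicClosure m Ω) := θ.liftNormal (algebraicClosure m Ω)
  have h : τ (z : algebraicClosure m Ω) = ((θ z : M) : algebraicClosure m Ω) :=
    AlgEquiv.liftNormal_commutes θ (algebraicClosure m Ω) z
  rw [← h]
  exact apply_mem_iff_mem_of_isGalois V m M L hmL hL hML τ z

end Literature.AlgebraicGeometry.Resolution

end
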